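import Summits.HodgeConjecture.CorCM.IrreducibleOddWeightsCanonicalPivotCriteria
import HarnessLib

/-!
# Canonical pivot, XI: COUNTING THE TRACE CLASSES — `#classes = [a(K₀) ∩ L₁ : ℚ]` for every embedding `a`, and the
# complex classes are ALL OR NONE

COR-CM (cell `pub-hodgecm2`, binder seat `b16` gen 66, count-neutral claim TRACE COUNT, file T1 — CM fields; theorems
only, no definition, no named fact, no `sorry`).  NEW as stated, hence under `Summits/`.  HONEST FRAMING: unconditional
counting statements about the embeddings of ARBITRARY CM fields feeding the defect formula for `dim MT(A₀ × A₁)`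
(gen 65, C2/C9); no Hodge class is claimed algebraic; `HC_CM` is neither used nor asserted.  This closes honest-open
item (i) of the gen-65 card CANONICAL-PIVOT («the identification #trace classes `= [K₀ ∩ L₁ : ℚ]`, #complex classes
`= 2·r₂(K₀ ∩ L₁)` is left in the docstrings»).

SETTING.  CM fields `K_i` (`i ∈ I`), types `Φ_i`, `A_i ⊨ (K_i; Φ_i)`; `L₁ = normalClosure ℚ K_{i₁} ℂ` the Galois closure
of `K_{i₁}` IN `ℂ`.  Gen 65 (files C2, C9, C11) proved, for ANY two CM fields and types,

  `2·(cmTypeRank Φ₀ + cmTypeRank Φ₁) ≤ 2·(cmFamilyRank Φ + 1) + #{complex trace classes}`,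

where the TRACE CLASSES are the sets `C_a = {t : K_{i₀} → ℂ | t = a on a⁻¹(L₁)}` (the orbits of `Aut(ℂ/L₁)` on
`Hom(K_{i₀}, ℂ)`) and `C` is complex when `C̄ ≠ C`.  Here the classes are COUNTED:

* §1 **`apply_mem_normalClosure_iff`** — the TRACE FIELD `a⁻¹(L₁) = {k | a k ∈ L₁} ≤ K_{i₀}` does not depend on the
  embedding `a` (`L₁` is stable under `Aut(ℂ)`, which is transitive on `Hom(K_{i₀}, ℂ)`); hence
  **`finrank_fieldRange_inf_normalClosure_eq`**: `[a(K_{i₀}) ∩ L₁ : ℚ]` is the same for all `a`.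
* §2 **`card_traceClasses_eq_finrank`** — the classes are the fibres of restriction to the trace field, every
  embedding of the trace field extends, so **`#classes = [a(K_{i₀}) ∩ L₁ : ℚ]`** (any `a`).
* §3 ALL OR NONE (**`card_complexTraceClasses_eq_zero_of_forall_mem`**, **`card_complexTraceClasses_eq_finrank_of_not_mem`**):
  the trace field of a CM field is either inside the maximal real subfield `K_{i₀}⁺` — then NO class is complex — or
  not — then EVERY class is complex (one `k` in the trace with `ρ k ≠ k` is moved by conjugation under every embedding,
  Mathlib's `complexEmbedding_complexConj`); so `#complex classes ∈ {0, [a(K_{i₀}) ∩ L₁ : ℚ]}` — the «`2·r₂`» of the card,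
  as a subfield of a CM field is totally real or totally imaginary.
* The numeric consequences (`2·defect ≤ [K₀ ∩ L₁ : ℚ]`, one-embedding criteria, sharpness) are in the sequel
  `IrreducibleOddWeightsCanonicalPivotTraceSharp`.

RECONCILIATION (honest).  The type-free «real trace ⟹ additive» criterion of C2/C7 is the one-conjugate criterion of
`GaloisClosureMeetsOneConjugateHodge.pairwise_of_oneConjugate` (gen 40) re-derived from the exact defect; the EXACT type-free
criterion for nondegenerate types is (PC) of `PointwiseConjugationCMFieldsHodge.pairwise_iff_pointwiseConj` (gen 48).  What
is new in the trace files is the NUMBER `[K₀ ∩ L₁ : ℚ]/2` bounding the interaction of arbitrary (degenerate or not) types.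

## References

* [Lang2002] S. Lang, *Algebra*, GTM 211, V §2 Thm. 2.8 (extension of embeddings), VI §1 Thm. 1.1, Cor. 1.6, Thm. 1.12.
* [Shimura1998] G. Shimura, *Abelian Varieties with Complex Multiplication and Modular Functions*, §8.1, §18.2 Lemma.
* [Gordon1999HodgeAVSurvey] B. B. Gordon, *A survey of the Hodge conjecture for abelian varieties*, §3 Theorem (proof),
  7.5–7.7, 9.2–9.3.
* [MoonenZarhin1999LowDim] B. Moonen, Yu. Zarhin, *Hodge classes on abelian varieties of low dimension*, Thm. (0.2).
-/

set_option autoImplicit false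

noncomputable section

open scoped BigOperators Classical

open NumberField Module IntermediateField

namespace Summit.HodgeConjecture.CorCM

open Literature.NumberTheory.ComplexMultiplication
open Literature.AlgebraicGeometry.Motives (CMType)
open Literature.AlgebraicGeometry.Pohlmann1968

/-! ### §1 The trace field does not depend on the embedding -/

section Trace

variable {I : Type} {K : I → Type} [∀ i, Field (K i)] [∀ i, NumberField (K i)]

/-- The Galois closure of a number field in `ℂ` is stable under every automorphism of `ℂ` (it is the compositum of the
images of all embeddings, which are permuted). [cite: Lang2002, V §3 Thm. 3.3] -/
theorem ringEquiv_apply_mem_normalClosure (i : I) (σ : ℂ ≃+* ℂ) {z : ℂ} (hz : z ∈ normalClosure ℚ (K i) ℂ) :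
    σ z ∈ normalClosure ℚ (K i) ℂ := by
  let φ : ℂ →ₐ[ℚ] ℂ := (AlgEquiv.ofRingEquiv (f := σ) fun q => by rw [eq_ratCast, map_ratCast]).toAlgHom
  have hle : normalClosure ℚ (K i) ℂ ≤ (normalClosure ℚ (K i) ℂ).comap φ := by
    refine normalClosure_le_iff.2 fun f => ?_
    rintro _ ⟨y, rfl⟩
    change φ (f y) ∈ normalClosure ℚ (K i) ℂ
    exact (φ.comp f).fieldRange_le_normalClosure ⟨y, rfl⟩
  exact hle hz

/-- **THE TRACE FIELD DOES NOT DEPEND ON THE EMBEDDING**: `a k ∈ L₁ ↔ a' k ∈ L₁` for any two complex embeddings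
`a, a'` of `K_{i₀}` (`a' = σ ∘ a` for some `σ ∈ Aut(ℂ)`, and `σ(L₁) = L₁`).  So `a⁻¹(L₁) ≤ K_{i₀}` is ONE subfield,
«`K₀ ∩ L₁`». [cite: Lang2002, V §2 Thm. 2.8 and VI §1 Thm. 1.1] -/
theorem apply_mem_normalClosure_iff {i₀ : I} (i₁ : I) (a a' : K i₀ →+* ℂ) (k : K i₀) :
    a k ∈ normalClosure ℚ (K i₁) ℂ ↔ a' k ∈ normalClosure ℚ (K i₁) ℂ := by
  haveI := isPretransitive_ringEquiv_complex (K := K i₀)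
  obtain ⟨σ, hσ⟩ := MulAction.exists_smul_eq (ℂ ≃+* ℂ) a a'
  have h1 : a' k = σ (a k) := by rw [← hσ, ringEquiv_smul_apply]
  have h2 : a k = σ.symm (a' k) := by rw [h1, RingEquiv.symm_apply_apply]
  constructor
  · intro h
    rw [h1]
    exact ringEquiv_apply_mem_normalClosure i₁ σ h
  · intro h
    rw [h2]
    exact ringEquiv_apply_mem_normalClosure i₁ σ.symm h

/-- The trace field as an intermediate field of `K_{i₀}/ℚ` (`comap` of `L₁`) is the same for all embeddings.
[cite: Lang2002, VI §1 Thm. 1.1] -/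
theorem comap_normalClosure_eq {i₀ : I} (i₁ : I) (a a' : K i₀ →+* ℂ) :
    (normalClosure ℚ (K i₁) ℂ).comap a.toRatAlgHom = (normalClosure ℚ (K i₁) ℂ).comap a'.toRatAlgHom :=
  IntermediateField.ext fun k => apply_mem_normalClosure_iff i₁ a a' k

/-- The embedding `a` maps the trace field `a⁻¹(L₁)` isomorphically onto `a(K_{i₀}) ∩ L₁`.
[cite: Lang2002, VI §1 Thm. 1.1] -/
theorem map_comap_normalClosure_eq {i₀ : I} (i₁ : I) (a : K i₀ →+* ℂ) :
    ((normalClosure ℚ (K i₁) ℂ).comap a.toRatAlgHom).map a.toRatAlgHom =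
      a.toRatAlgHom.fieldRange ⊓ normalClosure ℚ (K i₁) ℂ := by
  refine le_antisymm ?_ ?_
  · rintro x hx
    obtain ⟨k, hk, rfl⟩ := (IntermediateField.mem_map _).1 hx
    exact ⟨AlgHom.mem_fieldRange.2 ⟨k, rfl⟩, hk⟩
  · rintro x ⟨hx₀, hx₁⟩
    obtain ⟨k, rfl⟩ := AlgHom.mem_fieldRange.1 hx₀
    exact (IntermediateField.mem_map _).2 ⟨k, hx₁, rfl⟩

/-- `[a⁻¹(L₁) : ℚ] = [a(K_{i₀}) ∩ L₁ : ℚ]`. [cite: Lang2002, VI §1 Thm. 1.1] -/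
theorem finrank_comap_normalClosure_eq {i₀ : I} (i₁ : I) (a : K i₀ →+* ℂ) :
    finrank ℚ ↥((normalClosure ℚ (K i₁) ℂ).comap a.toRatAlgHom) =
      finrank ℚ ↥(a.toRatAlgHom.fieldRange ⊓ normalClosure ℚ (K i₁) ℂ) := by
  rw [(IntermediateField.equivMap ((normalClosure ℚ (K i₁) ℂ).comap a.toRatAlgHom)
      a.toRatAlgHom).toLinearEquiv.finrank_eq]
  exact (IntermediateField.equivOfEq (map_comap_normalClosure_eq i₁ a)).toLinearEquiv.finrank_eq

/-- **The degree of the trace `[a(K_{i₀}) ∩ L₁ : ℚ]` is the same for every embedding `a`.**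
[cite: Lang2002, VI §1 Thm. 1.1 and V §2 Thm. 2.8] -/
theorem finrank_fieldRange_inf_normalClosure_eq {i₀ : I} (i₁ : I) (a a' : K i₀ →+* ℂ) :
    finrank ℚ ↥(a.toRatAlgHom.fieldRange ⊓ normalClosure ℚ (K i₁) ℂ) =
      finrank ℚ ↥(a'.toRatAlgHom.fieldRange ⊓ normalClosure ℚ (K i₁) ℂ) := by
  rw [← finrank_comap_normalClosure_eq i₁ a, ← finrank_comap_normalClosure_eq i₁ a']
  exact (IntermediateField.equivOfEq (comap_normalClosure_eq i₁ a a')).toLinearEquiv.finrank_eq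

/-! ### §2 The classes are the fibres of restriction to the trace field; their number -/

/-- `t` lies in the trace class of `a` iff `t` and `a` have the same restriction to the trace field (taken through a
fixed embedding `a₀`). [cite: Lang2002, VI §1 Thm. 1.1 and Cor. 1.6] -/
theorem forall_apply_eq_iff_comp_eq {i₀ : I} (i₁ : I) (a₀ a t : K i₀ →+* ℂ) :
    (∀ k : K i₀, a k ∈ normalClosure ℚ (K i₁) ℂ → t k = a k) ↔
      t.comp (algebraMap ↥((normalClosure ℚ (K i₁) ℂ).comap a₀.toRatAlgHom) (K i₀)) =
        a.comp (algebraMap ↥((normalClosure ℚ (K i₁) ℂ).comap a₀.toRatAlgHom) (K i₀)) := by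
  constructor
  · intro h
    refine RingHom.ext fun k => ?_
    rw [RingHom.comp_apply, RingHom.comp_apply, IntermediateField.algebraMap_apply]
    exact h k ((apply_mem_normalClosure_iff i₁ a a₀ k).2 k.2)
  · intro h k hk
    have hk₀ : a₀ k ∈ normalClosure ℚ (K i₁) ℂ := (apply_mem_normalClosure_iff i₁ a a₀ k).1 hk
    have := RingHom.congr_fun h ⟨k, hk₀⟩
    rwa [RingHom.comp_apply, RingHom.comp_apply, IntermediateField.algebraMap_apply] at this

/-- The trace class of `a`, as a finite set, is the fibre of the restriction map over the restriction of `a`.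
[cite: Lang2002, VI §1 Thm. 1.1 and Cor. 1.6] -/
theorem filter_traceClass_eq_filter_comp_eq {i₀ : I} (i₁ : I) (a₀ a : K i₀ →+* ℂ) :
    Finset.univ.filter (fun t : K i₀ →+* ℂ => ∀ k : K i₀, a k ∈ normalClosure ℚ (K i₁) ℂ → t k = a k) =
      Finset.univ.filter (fun t : K i₀ →+* ℂ =>
        t.comp (algebraMap ↥((normalClosure ℚ (K i₁) ℂ).comap a₀.toRatAlgHom) (K i₀)) =
          a.comp (algebraMap ↥((normalClosure ℚ (K i₁) ℂ).comap a₀.toRatAlgHom) (K i₀))) :=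
  Finset.filter_congr fun t _ => forall_apply_eq_iff_comp_eq i₁ a₀ a t

/-- **Every complex embedding of an intermediate field of `K_{i₀}` extends to `K_{i₀}`** (`ℂ` is algebraically closed
and `K_{i₀}` is algebraic over the subfield). [cite: Lang2002, V §2 Thm. 2.8] -/
theorem exists_comp_algebraMap_eq {i₀ : I} (T : IntermediateField ℚ (K i₀)) (s : ↥T →+* ℂ) :
    ∃ t : K i₀ →+* ℂ, t.comp (algebraMap ↥T (K i₀)) = s := by
  letI : Algebra ↥T ℂ := s.toAlgebra
  haveI : Module.IsTorsionFree ↥T ℂ := DivisionSemiring.to_moduleIsTorsionFree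
  haveI : Module.IsTorsionFree ↥T (K i₀) := DivisionSemiring.to_moduleIsTorsionFree
  haveI : Algebra.IsAlgebraic ↥T (K i₀) := Algebra.IsAlgebraic.tower_top (K := ℚ) ↥T
  let ψ : K i₀ →ₐ[↥T] ℂ := IsAlgClosed.lift
  exact ⟨ψ.toRingHom, ψ.comp_algebraMap⟩

/-- **THE NUMBER OF TRACE CLASSES IS THE DEGREE OF THE TRACE FIELD**: the classes of embeddings of `K_{i₀}` agreeing
on the trace `a⁻¹(L₁)` are the fibres of restriction to the trace field `T`, restriction is onto `Hom(T, ℂ)`, and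
`#Hom(T, ℂ) = [T : ℚ]`; through the fixed embedding `a₀`, `#classes = [a₀⁻¹(L₁) : ℚ]`.
[cite: Lang2002, VI §1 Thm. 1.1, Cor. 1.6 and V §2 Thm. 2.8] -/
theorem card_traceClasses_eq_finrank_comap {i₀ : I} (i₁ : I) (a₀ : K i₀ →+* ℂ) :
    (Finset.univ.image fun a : K i₀ →+* ℂ =>
        Finset.univ.filter (fun t : K i₀ →+* ℂ => ∀ k : K i₀, a k ∈ normalClosure ℚ (K i₁) ℂ → t k = a k)).card =
      finrank ℚ ↥((normalClosure ℚ (K i₁) ℂ).comap a₀.toRatAlgHom) := by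
  set T : IntermediateField ℚ (K i₀) := (normalClosure ℚ (K i₁) ℂ).comap a₀.toRatAlgHom with hT
  let res : (K i₀ →+* ℂ) → (↥T →+* ℂ) := fun t => t.comp (algebraMap ↥T (K i₀))
  have hsurj : Function.Surjective res := fun s => exists_comp_algebraMap_eq T s
  -- the classes are the fibres of `res`
  have himage : (Finset.univ.image fun a : K i₀ →+* ℂ =>
        Finset.univ.filter (fun t : K i₀ →+* ℂ => ∀ k : K i₀, a k ∈ normalClosure ℚ (K i₁) ℂ → t k = a k)) =
      (Finset.univ : Finset (↥T →+* ℂ)).image fun s => Finset.univ.filter fun t : K i₀ →+* ℂ => res t = s := by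
    rw [← Finset.image_univ_of_surjective hsurj, Finset.image_image]
    exact Finset.image_congr fun a _ => filter_traceClass_eq_filter_comp_eq i₁ a₀ a
  -- distinct restrictions have distinct (non-empty) fibres
  have hinj : Function.Injective fun s : ↥T →+* ℂ => Finset.univ.filter fun t : K i₀ →+* ℂ => res t = s := by
    intro s s' h
    obtain ⟨t, ht⟩ := hsurj s
    have hmem : t ∈ (fun s : ↥T →+* ℂ => Finset.univ.filter fun t : K i₀ →+* ℂ => res t = s) s :=
      Finset.mem_filter.2 ⟨Finset.mem_univ _, ht⟩
    rw [h] at hmem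
    exact ht.symm.trans (Finset.mem_filter.1 hmem).2
  rw [himage, Finset.card_image_of_injective _ hinj, Finset.card_univ]
  exact Embeddings.card ↥T ℂ

/-- **`#trace classes = [a(K_{i₀}) ∩ L₁ : ℚ]`** for EVERY embedding `a : K_{i₀} → ℂ` (the count of the gen-65 card,
C9 docstring, now a theorem). [cite: Lang2002, VI §1 Thm. 1.1, Cor. 1.6 and Thm. 1.12] -/
theorem card_traceClasses_eq_finrank {i₀ : I} (i₁ : I) (a : K i₀ →+* ℂ) :
    (Finset.univ.image fun a : K i₀ →+* ℂ =>
        Finset.univ.filter (fun t : K i₀ →+* ℂ => ∀ k : K i₀, a k ∈ normalClosure ℚ (K i₁) ℂ → t k = a k)).card =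
      finrank ℚ ↥(a.toRatAlgHom.fieldRange ⊓ normalClosure ℚ (K i₁) ℂ) := by
  rw [card_traceClasses_eq_finrank_comap i₁ a, finrank_comap_normalClosure_eq]

/-- **Each class has `[K_{i₀} : ℚ] / [a(K_{i₀}) ∩ L₁ : ℚ]` … in total: `#classes` divides nothing here; what we record
is the partition count `Σ_C #C = [K_{i₀} : ℚ]`** — the classes partition `Hom(K_{i₀}, ℂ)`.
[cite: Lang2002, VI §1 Thm. 1.1 and Thm. 1.12] -/
theorem sum_card_traceClasses_eq_finrank {i₀ : I} (i₁ : I) :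
    ∑ C ∈ (Finset.univ.image fun a : K i₀ →+* ℂ =>
        Finset.univ.filter (fun t : K i₀ →+* ℂ => ∀ k : K i₀, a k ∈ normalClosure ℚ (K i₁) ℂ → t k = a k)),
      C.card = finrank ℚ (K i₀) := by
  obtain ⟨a₀⟩ : Nonempty (K i₀ →+* ℂ) := inferInstance
  set T : IntermediateField ℚ (K i₀) := (normalClosure ℚ (K i₁) ℂ).comap a₀.toRatAlgHom with hT
  let res : (K i₀ →+* ℂ) → (↥T →+* ℂ) := fun t => t.comp (algebraMap ↥T (K i₀))
  have himage : (Finset.univ.image fun a : K i₀ →+* ℂ =>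
        Finset.univ.filter (fun t : K i₀ →+* ℂ => ∀ k : K i₀, a k ∈ normalClosure ℚ (K i₁) ℂ → t k = a k)) =
      (Finset.univ.image res).image fun s => Finset.univ.filter fun t : K i₀ →+* ℂ => res t = s := by
    rw [Finset.image_image]
    exact Finset.image_congr fun a _ => filter_traceClass_eq_filter_comp_eq i₁ a₀ a
  rw [himage, ← Embeddings.card (K i₀) ℂ, ← Finset.card_univ, Finset.card_eq_sum_card_image res Finset.univ]
  refine (Finset.sum_image ?_).trans (Finset.sum_congr rfl fun s _ => by rw [Finset.filter_congr fun t _ => Iff.rfl])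
  -- injectivity of `s ↦ fibre(s)` on the image of `res`
  rintro s hs s' - h
  obtain ⟨t, -, rfl⟩ := Finset.mem_image.1 hs
  have hmem : t ∈ (fun s : ↥T →+* ℂ => Finset.univ.filter fun t' : K i₀ →+* ℂ => res t' = s) (res t) :=
    Finset.mem_filter.2 ⟨Finset.mem_univ _, rfl⟩
  rw [h] at hmem
  exact (Finset.mem_filter.1 hmem).2

end Trace

/-! ### §3 Complex classes: all or none -/

section Complex

variable {I : Type} {K : I → Type} [∀ i, Field (K i)] [∀ i, NumberField (K i)]

/-- Conjugation maps the class of `a` onto the class of `ā`. [cite: Shimura1998, §18.2 Lemma (i)]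
[cite: Lang2002, VI §1 Cor. 1.6] -/
theorem image_conj_traceClass_eq {i₀ : I} (i₁ : I) (a : K i₀ →+* ℂ) :
    (Finset.univ.filter (fun t : K i₀ →+* ℂ => ∀ k : K i₀, a k ∈ normalClosure ℚ (K i₁) ℂ → t k = a k)).image
        (fun t => (starRingAut : ℂ ≃+* ℂ) • t) =
      Finset.univ.filter (fun t : K i₀ →+* ℂ => ∀ k : K i₀,
        ((starRingAut : ℂ ≃+* ℂ) • a) k ∈ normalClosure ℚ (K i₁) ℂ → t k = ((starRingAut : ℂ ≃+* ℂ) • a) k) := by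
  -- one inclusion for every `a`, then involutivity
  have key : ∀ (b t : K i₀ →+* ℂ), (∀ k : K i₀, b k ∈ normalClosure ℚ (K i₁) ℂ → t k = b k) →
      ∀ k : K i₀, ((starRingAut : ℂ ≃+* ℂ) • b) k ∈ normalClosure ℚ (K i₁) ℂ →
        ((starRingAut : ℂ ≃+* ℂ) • t) k = ((starRingAut : ℂ ≃+* ℂ) • b) k := by
    intro b t h k hk
    rw [ringEquiv_smul_apply, ringEquiv_smul_apply,
      h k ((apply_mem_normalClosure_iff i₁ ((starRingAut : ℂ ≃+* ℂ) • b) b k).1 hk)]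
  have hinv : ∀ t : K i₀ →+* ℂ, (starRingAut : ℂ ≃+* ℂ) • ((starRingAut : ℂ ≃+* ℂ) • t) = t := fun t =>
    RingHom.ext fun k => by rw [ringEquiv_smul_apply, ringEquiv_smul_apply, starRingAut_apply, starRingAut_apply,
      star_star]
  ext t
  simp only [Finset.mem_image, Finset.mem_filter, Finset.mem_univ, true_and]
  constructor
  · rintro ⟨t', ht', rfl⟩
    exact key a t' ht'
  · intro ht
    refine ⟨(starRingAut : ℂ ≃+* ℂ) • t, ?_, hinv t⟩
    have h := key _ _ ht
    rw [hinv a] at h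
    exact h

/-- **A class is complex iff conjugation moves the trace**: `C̄_a ≠ C_a ↔ ∃ k, a k ∈ L₁ ∧ conj (a k) ≠ a k`.
[cite: Shimura1998, §18.2 Lemma (i)] [cite: Lang2002, VI §1 Cor. 1.6] -/
theorem image_conj_traceClass_ne_iff {i₀ : I} (i₁ : I) (a : K i₀ →+* ℂ) :
    (Finset.univ.filter (fun t : K i₀ →+* ℂ => ∀ k : K i₀, a k ∈ normalClosure ℚ (K i₁) ℂ → t k = a k)).image
        (fun t => (starRingAut : ℂ ≃+* ℂ) • t) ≠
      Finset.univ.filter (fun t : K i₀ →+* ℂ => ∀ k : K i₀, a k ∈ normalClosure ℚ (K i₁) ℂ → t k = a k) ↔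
      ∃ k : K i₀, a k ∈ normalClosure ℚ (K i₁) ℂ ∧ starRingEnd ℂ (a k) ≠ a k := by
  rw [image_conj_traceClass_eq, filter_traceClass_eq_filter_comp_eq i₁ a ((starRingAut : ℂ ≃+* ℂ) • a),
    filter_traceClass_eq_filter_comp_eq i₁ a a]
  constructor
  · intro hne
    by_contra hall
    push Not at hall
    apply hne
    have heq : ((starRingAut : ℂ ≃+* ℂ) • a).comp
          (algebraMap ↥((normalClosure ℚ (K i₁) ℂ).comap a.toRatAlgHom) (K i₀)) =
        a.comp (algebraMap ↥((normalClosure ℚ (K i₁) ℂ).comap a.toRatAlgHom) (K i₀)) :=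
      (forall_apply_eq_iff_comp_eq i₁ a a _).1 fun k hk => by
        rw [ringEquiv_smul_apply, starRingAut_apply, ← starRingEnd_apply, hall k hk]
    rw [heq]
  · rintro ⟨k, hk, hne⟩ heq
    have hmem : a ∈ Finset.univ.filter fun t : K i₀ →+* ℂ =>
        t.comp (algebraMap ↥((normalClosure ℚ (K i₁) ℂ).comap a.toRatAlgHom) (K i₀)) =
          a.comp (algebraMap ↥((normalClosure ℚ (K i₁) ℂ).comap a.toRatAlgHom) (K i₀)) :=
      Finset.mem_filter.2 ⟨Finset.mem_univ _, rfl⟩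
    rw [← heq] at hmem
    have h := (Finset.mem_filter.1 hmem).2
    have h' := (forall_apply_eq_iff_comp_eq i₁ a ((starRingAut : ℂ ≃+* ℂ) • a) a).2 h k
      ((apply_mem_normalClosure_iff i₁ _ a k).2 hk)
    rw [ringEquiv_smul_apply, starRingAut_apply, ← starRingEnd_apply] at h'
    exact hne h'.symm

variable [∀ i, IsCMField (K i)]

/-- In a CM field, `conj (a k) = a k` for one embedding iff `k` lies in the maximal real subfield (iff for all
embeddings): `conj ∘ a = a ∘ ρ`. [cite: Shimura1998, §18.2 Lemma (i)] -/
theorem conj_apply_eq_iff_mem_maximalRealSubfield {i₀ : I} (a : K i₀ →+* ℂ) (k : K i₀) :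
    starRingEnd ℂ (a k) = a k ↔ k ∈ maximalRealSubfield (K i₀) := by
  rw [← IsCMField.complexConj_eq_self_iff, ← IsCMField.complexEmbedding_complexConj (K i₀) a k]
  exact a.injective.eq_iff

omit [∀ i, IsCMField (K i)] in
/-- **NONE**: if the trace field lies in `K_{i₀}⁺` (tested through one embedding `a₀`), no trace class is complex.
[cite: Shimura1998, §18.2 Lemma (i)] [cite: Lang2002, VI §1 Cor. 1.6] -/
theorem card_complexTraceClasses_eq_zero_of_forall_mem {i₀ : I} (i₁ : I) (a₀ : K i₀ →+* ℂ)
    (h : ∀ k : K i₀, a₀ k ∈ normalClosure ℚ (K i₁) ℂ → k ∈ maximalRealSubfield (K i₀)) :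
    ((Finset.univ.image fun a : K i₀ →+* ℂ =>
          Finset.univ.filter (fun t : K i₀ →+* ℂ => ∀ k : K i₀, a k ∈ normalClosure ℚ (K i₁) ℂ → t k = a k)).filter
        fun C => C.image (fun t => (starRingAut : ℂ ≃+* ℂ) • t) ≠ C).card = 0 := by
  rw [Finset.card_eq_zero, Finset.filter_eq_empty_iff]
  intro C hC
  obtain ⟨a, -, rfl⟩ := Finset.mem_image.1 hC
  rw [image_conj_traceClass_ne_iff]
  push Not
  intro k hk
  exact conj_apply_eq_of_mem_maximalRealSubfield (h k ((apply_mem_normalClosure_iff i₁ a a₀ k).1 hk)) a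

/-- **ALL**: if some `k` of the trace field lies outside `K_{i₀}⁺`, EVERY trace class is complex, so the number of
complex classes is `[a₀(K_{i₀}) ∩ L₁ : ℚ]`. [cite: Shimura1998, §18.2 Lemma (i)] [cite: Lang2002, VI §1 Cor. 1.6 and Thm. 1.12] -/
theorem card_complexTraceClasses_eq_finrank_of_not_mem {i₀ : I} (i₁ : I) (a₀ : K i₀ →+* ℂ) {k₀ : K i₀}
    (hk₀ : a₀ k₀ ∈ normalClosure ℚ (K i₁) ℂ) (hreal : k₀ ∉ maximalRealSubfield (K i₀)) :
    ((Finset.univ.image fun a : K i₀ →+* ℂ =>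
          Finset.univ.filter (fun t : K i₀ →+* ℂ => ∀ k : K i₀, a k ∈ normalClosure ℚ (K i₁) ℂ → t k = a k)).filter
        fun C => C.image (fun t => (starRingAut : ℂ ≃+* ℂ) • t) ≠ C).card =
      finrank ℚ ↥(a₀.toRatAlgHom.fieldRange ⊓ normalClosure ℚ (K i₁) ℂ) := by
  rw [Finset.filter_true_of_mem, card_traceClasses_eq_finrank]
  intro C hC
  obtain ⟨a, -, rfl⟩ := Finset.mem_image.1 hC
  rw [image_conj_traceClass_ne_iff]
  exact ⟨k₀, (apply_mem_normalClosure_iff i₁ a a₀ k₀).2 hk₀,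
    fun h => hreal ((conj_apply_eq_iff_mem_maximalRealSubfield a k₀).1 h)⟩

/-- **ALL OR NONE**: the number of complex trace classes is `0` or `[a₀(K_{i₀}) ∩ L₁ : ℚ]` (a subfield of a CM field is
totally real or totally imaginary). [cite: Shimura1998, §18.2 Lemma (i)] [cite: Lang2002, VI §1 Thm. 1.12] -/
theorem card_complexTraceClasses_eq_zero_or_eq_finrank {i₀ : I} (i₁ : I) (a₀ : K i₀ →+* ℂ) :
    ((Finset.univ.image fun a : K i₀ →+* ℂ =>
          Finset.univ.filter (fun t : K i₀ →+* ℂ => ∀ k : K i₀, a k ∈ normalClosure ℚ (K i₁) ℂ → t k = a k)).filter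
        fun C => C.image (fun t => (starRingAut : ℂ ≃+* ℂ) • t) ≠ C).card = 0 ∨
    ((Finset.univ.image fun a : K i₀ →+* ℂ =>
          Finset.univ.filter (fun t : K i₀ →+* ℂ => ∀ k : K i₀, a k ∈ normalClosure ℚ (K i₁) ℂ → t k = a k)).filter
        fun C => C.image (fun t => (starRingAut : ℂ ≃+* ℂ) • t) ≠ C).card =
      finrank ℚ ↥(a₀.toRatAlgHom.fieldRange ⊓ normalClosure ℚ (K i₁) ℂ) := by
  by_cases h : ∀ k : K i₀, a₀ k ∈ normalClosure ℚ (K i₁) ℂ → k ∈ maximalRealSubfield (K i₀)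
  · exact Or.inl (card_complexTraceClasses_eq_zero_of_forall_mem i₁ a₀ h)
  · push Not at h
    obtain ⟨k₀, hk₀, hreal⟩ := h
    exact Or.inr (card_complexTraceClasses_eq_finrank_of_not_mem i₁ a₀ hk₀ hreal)

end Complex

end Summit.HodgeConjecture.CorCM

end
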